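import Mathlib
import Summits.Ventures.HodgeRepro.Tier4.Common.SaturationMeasure
import Summits.Ventures.HodgeRepro.Tier4.Common.ProdSliceBound
import Summits.Ventures.HodgeRepro.Tier4.Line4.UnitLowerBound
import Summits.Ventures.HodgeRepro.Tier4.Line4.CentreCocompact
import Summits.Ventures.HodgeRepro.Tier4.Line4.UnitInstance

/-!
# Tier4/Line4/UnitBeta — C-L4-UNIT-BETA: the (β) unit of record `hβ` of L1-p4's RatioGlue, `v n · ν′_f(L′_N) ≤ M₄ ·
suppMeasure N γ₀` with the currency `v n := ν_f(Z⁰_f · L_N)` (the LOCAL level-one centre `Z⁰_f := Z_f ∩ K_T(1)`)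

Blind re-derivation cell `pub-hodge-repro`, Tier 4 «prove the step» (README §9–§10), seat t4-L2-p2 (gen 5; plan-4 g6's cut
S15775 «C-L4-UNIT-BETA = `hβ` in L1-p4's form», crit-1 g11's R-CUR-LOCAL S15784: the currency names the LOCAL `Z⁰_f`).  Tree
path `lean/Summits/Ventures/HodgeRepro/Tier4/Line4/UnitBeta.lean`.  Imports typer-1's `Common/SaturationMeasure` ((β1)
`measure_le_card_inf_mul_measure_inter_of_mul_subset`) and `Common/ProdSliceBound` ((β2) `prod_measure_inter_prod_univ_ge`),
L1-p4's `Line4/UnitLowerBound` (`exists_diag_of_mem_ZfIn`, `smul_levelTf_prod_subset_suppSet`; through `Line4/CentralCover`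
`measure_smul_set_eq`), typer-2's `Line4/CentreCocompact` (`ofFinPart_mem_centre`) and this seat's `Line4/UnitInstance`
(`levelTfSub`, `finite_centreFin_inter_levelTf`; through it `Line4/CentreFinDomain`, `Line4/LevelVolume`).  Two
definitions (`levelOneCentre`, `unitCurrency`); no literature.

THE OBJECTS.  `levelOneCentre W := ZfIn W ⊓ levelTfSub W 1` — the local level-one centre `Z⁰_f = Z_f ∩ K_T(1)` of
crit-1's R-CUR-LOCAL (S15784), central in `T_f`, compact open; **`unitCurrency W νf lev n := νf (Z⁰_f · levelTf W (lev n))`**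
— the currency `v n` shared with L1-p4's currency match `hcur` (spell it by THIS name on both sides).

THE STATEMENT.  **`unit_beta`**: for a Haar pair `(νf, νf′)`, a fundamental domain `DZf` for `centreFin W` (`hfd`), the CM
input `CentreFinFinite W` and any level sequence `lev` with `lev n ≠ 0`:
`unitCurrency W νf lev n * νf′ (levelTf′ W (lev n)) ≤ #(centreFin W ⊓ levelTfSub W 1) * suppMeasure W νf νf′ γ₀ DZf (lev n) γ₀`
for every `n` — RatioGlue's `hβ` binder verbatim with `v := unitCurrency W νf lev` and
`M₄ := #(Z(k)_f ∩ K_T(1))`, a constant FREE of `n` and of the level.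

THE PROOF ((β1)+(β2) by name).  `H := Z⁰_f ⊔ L_N` has carrier `Z⁰_f · L_N` (`Z⁰_f` normal, being central); (β1) on `T_f`
with `Γ := centreFin W`, `D := DZf`, `E := Z_f · L_N ⊇ Γ · H` (`centreFin ≤ ZfIn`): `νf(H) ≤ #(Γ ⊓ H) · νf(E ∩ DZf)`, the
`[Finite (H.subgroupOf Γ)]` instance from `Γ ∩ K_T(1)` finite (`finite_centreFin_inter_levelTf`) since `H ≤ K_T(1)`, and
`#(Γ ⊓ H) ≤ #(Γ ⊓ K_T(1))` for the same reason; (β2) Fubini on `suppSet γ₀ N γ₀ ∩ DZf ×ˢ univ` with the slice bound at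
`c = z l ∈ Z_f · L_N`: the slice contains `ζ • L′_N` for the diagonal partner `ζ` of `z`
(`smul_levelTf_prod_subset_suppSet`), of measure `νf′(L′_N)` (`measure_smul_set_eq`).

Nothing here says anything about the status of the Hodge conjecture for CM abelian varieties, which is NOT proved
(HC_CM is NOT proved by anyone in this repository).
-/

set_option autoImplicit false

noncomputable section

namespace Summit.Ventures.HodgeRepro.Tier4.Line4

open Summit.Ventures.HodgeRepro.Tier4 Summit.Ventures.HodgeRepro.Tier4.Common
  Summit.Ventures.HodgeRepro.Tier4.Line1 MeasureTheory NumberField IsDedekindDomain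
open scoped NumberField NNReal ENNReal Pointwise Topology

section Currency

variable {k : Type} [Field k] [NumberField k] (W : PlaneData k)

/-- **The local level-one centre** `Z⁰_f := Z_f ∩ K_T(1)` (crit-1 R-CUR-LOCAL): the finite centre inside the level-one
trace, a compact open subgroup of `T_f`. -/
def levelOneCentre : Subgroup (torusFin W) := ZfIn W ⊓ levelTfSub W 1

/-- Membership in `Z⁰_f`. -/
theorem mem_levelOneCentre {b : torusFin W} : b ∈ levelOneCentre W ↔ b ∈ ZfIn W ∧ b ∈ levelTf W 1 := Iff.rfl

/-- The underlying element of a point of `Z_f ≤ T_f` is central in `G(𝔸)` (UnitLowerBound's `exists_diag_of_mem_ZfIn`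
packages this with the diagonal partner). -/
theorem coe_mem_center_of_mem_ZfIn {z : torusFin W} (hz : z ∈ ZfIn W) :
    ((z : torusT W) : GA W) ∈ Subgroup.center (GA W) :=
  (exists_diag_of_mem_ZfIn W hz).choose_spec.2

/-- **`Z⁰_f` is central in `T_f`**. -/
theorem levelOneCentre_le_center : levelOneCentre W ≤ Subgroup.center (torusFin W) := by
  intro z hz
  rw [Subgroup.mem_center_iff]
  intro b
  apply Subtype.ext
  apply Subtype.ext
  exact Subgroup.mem_center_iff.1 (coe_mem_center_of_mem_ZfIn W hz.1) _

/-- `Z⁰_f` is a normal subgroup of `T_f` (central). -/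
theorem levelOneCentre_normal : (levelOneCentre W).Normal := by
  refine ⟨fun z hz g => ?_⟩
  have h := Subgroup.mem_center_iff.1 (levelOneCentre_le_center W hz) g
  rw [h, mul_inv_cancel_right]
  exact hz

/-- **The rational centre lies in the finite centre**: `centreFin W ≤ ZfIn W` (the finite part of a central rational
element is central, `ofFinPart_mem_centre`). -/
theorem centreFin_le_ZfIn : centreFin W ≤ ZfIn W := by
  rintro _ ⟨ζ, hζ, rfl⟩
  show (((finTfHom W ζ : torusFin W) : torusT W) : GA W) ∈ centre W
  rw [coe_coe_finTfHom]
  exact ofFinPart_mem_centre W (rationalCentreT.mem_centre W hζ)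

/-- `K(N) ≤ K(M)` whenever `M ∣ N` (the general antitone law, from `modSet_antitone`). -/
theorem levelK_le_of_dvd {M N : ℕ} (h : M ∣ N) : levelK W N ≤ levelK W M := by
  intro g hg
  rw [mem_levelK] at hg ⊢
  refine ⟨fun i j => ⟨(hg.1 i j).1, ?_⟩, fun i j => ⟨(hg.2 i j).1, ?_⟩⟩
  · exact modSet_antitone k h (hg.1 i j).2
  · exact modSet_antitone k h (hg.2 i j).2

/-- `levelTfSub N ≤ levelTfSub M` whenever `M ∣ N`. -/
theorem levelTfSub_le_of_dvd {M N : ℕ} (h : M ∣ N) : levelTfSub W N ≤ levelTfSub W M :=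
  fun _ hb => levelK_le_of_dvd W h hb

/-- The carrier of `Z⁰_f ⊔ L_N` is the product set `Z⁰_f · L_N`. -/
theorem coe_levelOneCentre_sup_levelTfSub (N : ℕ) :
    ((levelOneCentre W ⊔ levelTfSub W N : Subgroup (torusFin W)) : Set (torusFin W)) =
      (levelOneCentre W : Set (torusFin W)) * levelTf W N :=
  haveI := levelOneCentre_normal W
  Subgroup.normal_mul (levelOneCentre W) (levelTfSub W N)

/-- The carrier of `Z⁰_f` is the set `Z_f ∩ levelTf 1` (L1-p4's spelling of the currency, S15800). -/
theorem coe_levelOneCentre :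
    (levelOneCentre W : Set (torusFin W)) = (ZfIn W : Set (torusFin W)) ∩ levelTf W 1 := rfl

/-- **The currency** `v n := ν_f(Z⁰_f · levelTf (lev n))` of the unit bound and of the currency match (R-CUR-LOCAL). -/
def unitCurrency [MeasurableSpace (GA W)] (νf : Measure (torusFin W)) (lev : ℕ → ℕ) (n : ℕ) : ℝ≥0∞ :=
  νf ((levelOneCentre W : Set (torusFin W)) * levelTf W (lev n))

/-- The currency, unfolded. -/
theorem unitCurrency_def [MeasurableSpace (GA W)] (νf : Measure (torusFin W)) (lev : ℕ → ℕ) (n : ℕ) :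
    unitCurrency W νf lev n = νf ((levelOneCentre W : Set (torusFin W)) * levelTf W (lev n)) := rfl

/-- The currency in L1-p4's spelling (`currency_match`, S15800): `ν_f((Z_f ∩ levelTf 1) · levelTf (lev n))`. -/
theorem unitCurrency_eq_set [MeasurableSpace (GA W)] (νf : Measure (torusFin W)) (lev : ℕ → ℕ) (n : ℕ) :
    unitCurrency W νf lev n = νf (((ZfIn W : Set (torusFin W)) ∩ levelTf W 1) * levelTf W (lev n)) := rfl

end Currency

section Beta

variable {k : Type} [Field k] [NumberField k] (W : PlaneData k) [MeasurableSpace (GA W)] [BorelSpace (GA W)]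
  (νf : Measure (torusFin W)) (νf' : Measure (torusFin' W)) (γ₀ : GA W) (DZf : Set (torusFin W))

/-- **The slice bound at a point of `Z_f · L_N`**: for `c = z l` (`z ∈ Z_f`, `l ∈ L_N`) the slice of `suppSet γ₀ N γ₀` at
`c` contains `ζ • L′_N` for the diagonal partner `ζ` of `z`, so its `ν′_f`-measure is `≥ ν′_f(L′_N)`. -/
theorem measure_levelTf'_le_measure_slice [νf'.IsHaarMeasure] (N : ℕ) {c : torusFin W}
    (hc : c ∈ (ZfIn W : Set (torusFin W)) * levelTf W N) :
    νf' (levelTf' W N) ≤ νf' (Prod.mk c ⁻¹' suppSet W γ₀ N γ₀) := by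
  haveI : BorelSpace (torusT' W) := Subtype.borelSpace _
  haveI : BorelSpace (torusFin' W) := Subtype.borelSpace _
  obtain ⟨z, hz, l, hl, rfl⟩ := hc
  obtain ⟨ζ, hζ, hzc⟩ := exists_diag_of_mem_ZfIn W hz
  calc νf' (levelTf' W N) = νf' (ζ • levelTf' W N) := (measure_smul_set_eq νf' ζ _).symm
    _ ≤ νf' (Prod.mk (z * l) ⁻¹' suppSet W γ₀ N γ₀) := by
      refine measure_mono fun c' hc' => ?_
      exact smul_levelTf_prod_subset_suppSet W γ₀ N hζ hzc ⟨⟨l, hl, rfl⟩, hc'⟩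

/-- **(β1) at a subgroup `H` with `Z⁰_f·L_N` as carrier, `H ≤ K_T(1)`**: `νf(H) ≤ #(Γ ⊓ K_T(1)) · νf((Z_f·L_N) ∩ DZf)`
(SaturationMeasure on `T_f`, `Γ := centreFin W`, `E := Z_f·L_N ⊇ Γ·H`; the finiteness instances from `Γ ∩ K_T(1)` finite). -/
theorem measure_le_card_mul_measure_inter_of_sup [νf.IsHaarMeasure]
    (hfd : IsFundamentalDomain (centreFin W) DZf νf) (hZ : CentreFinFinite W) {N : ℕ} (hN : N ≠ 0)
    (H : Subgroup (torusFin W)) (hHset : (H : Set (torusFin W)) = (levelOneCentre W : Set (torusFin W)) * levelTf W N)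
    (hHle : H ≤ levelTfSub W 1) :
    νf (H : Set (torusFin W)) ≤
      (Nat.card (centreFin W ⊓ levelTfSub W 1 : Subgroup (torusFin W)) : ℝ≥0∞) *
        νf (((ZfIn W : Set (torusFin W)) * levelTf W N) ∩ DZf) := by
  haveI : BorelSpace (torusT W) := Subtype.borelSpace _
  haveI : BorelSpace (torusFin W) := Subtype.borelSpace _
  haveI : T2Space (torusFin W) := t2Space_torusFin W
  haveI : SecondCountableTopology (torusFin W) := secondCountable_torusFin W
  haveI : DiscreteTopology (centreFin W) := discreteTopology_centreFin_of_centreFinFinite W hZ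
  haveI : Countable (centreFin W) := countable_of_discrete_of_secondCountable _
  haveI : MeasurableMul (torusFin W) :=
    ⟨fun c => (continuous_const.mul continuous_id).measurable, fun c => (continuous_id.mul continuous_const).measurable⟩
  have hHopen : IsOpen (H : Set (torusFin W)) := by
    rw [hHset]
    exact (isOpen_levelTf W hN).mul_left
  have hfin1 := finite_centreFin_inter_levelTf W hZ one_ne_zero
  haveI hfinK : Finite ↥(centreFin W ⊓ levelTfSub W 1) := hfin1.to_subtype
  haveI : Finite (H.subgroupOf (centreFin W)) := by
    refine Finite.of_injective
      (fun x : H.subgroupOf (centreFin W) =>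
        (⟨((x : centreFin W) : torusFin W),
          Subgroup.mem_inf.2 ⟨(x : centreFin W).2, hHle (Subgroup.mem_subgroupOf.1 x.2)⟩⟩ :
          ↥(centreFin W ⊓ levelTfSub W 1))) ?_
    intro x y hxy
    have h := congrArg Subtype.val hxy
    exact Subtype.ext (Subtype.ext h)
  have hcard : Nat.card (centreFin W ⊓ H : Subgroup (torusFin W)) ≤
      Nat.card (centreFin W ⊓ levelTfSub W 1 : Subgroup (torusFin W)) :=
    Subgroup.card_le_of_le (inf_le_inf_left _ hHle)
  have hE : (centreFin W : Set (torusFin W)) * (H : Set (torusFin W)) ⊆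
      (ZfIn W : Set (torusFin W)) * levelTf W N := by
    rw [hHset]
    rintro _ ⟨c, hc, _, ⟨z, hz, l, hl, rfl⟩, rfl⟩
    exact ⟨c * z, mul_mem (centreFin_le_ZfIn W hc) (Subgroup.mem_inf.1 hz).1, l, hl, mul_assoc c z l⟩
  have hβ1 := measure_le_card_inf_mul_measure_inter_of_mul_subset νf (centreFin W) hfd H hHopen.measurableSet hE
  calc νf (H : Set (torusFin W)) ≤ _ := hβ1
    _ ≤ _ := by gcongr

/-- **C-L4-UNIT-BETA — the (β) unit of record**: RatioGlue's `hβ` with `v := unitCurrency W νf lev` and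
`M₄ := #(Z(k)_f ∩ K_T(1))`, from (β1) (SaturationMeasure) and (β2) (ProdSliceBound) by name. -/
theorem unit_beta [νf.IsHaarMeasure] [νf'.IsHaarMeasure] (hDZf : MeasurableSet DZf)
    (hfd : IsFundamentalDomain (centreFin W) DZf νf) (hZ : CentreFinFinite W) (lev : ℕ → ℕ)
    (hlev : ∀ n, lev n ≠ 0) (n : ℕ) :
    unitCurrency W νf lev n * νf' (levelTf' W (lev n)) ≤
      (Nat.card (centreFin W ⊓ levelTfSub W 1 : Subgroup (torusFin W)) : ℝ≥0∞) *
        suppMeasure W νf νf' γ₀ DZf (lev n) γ₀ := by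
  have hN : lev n ≠ 0 := hlev n
  haveI : BorelSpace (torusT W) := Subtype.borelSpace _
  haveI : BorelSpace (torusFin W) := Subtype.borelSpace _
  haveI : BorelSpace (torusT' W) := Subtype.borelSpace _
  haveI : BorelSpace (torusFin' W) := Subtype.borelSpace _
  haveI : LocallyCompactSpace (torusFin' W) := locallyCompact_torusFin' W
  haveI : SecondCountableTopology (torusFin' W) := secondCountable_torusFin' W
  haveI : IsLocallyFiniteMeasure νf' := isLocallyFiniteMeasure_of_isFiniteMeasureOnCompacts
  haveI : SigmaFinite νf' := sigmaFinite_of_locallyFinite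
  -- (β1) at `H := Z⁰_f ⊔ L_N`
  have hβ1 := measure_le_card_mul_measure_inter_of_sup W νf DZf hfd hZ hN (levelOneCentre W ⊔ levelTfSub W (lev n))
    (coe_levelOneCentre_sup_levelTfSub W (lev n)) (sup_le inf_le_right (levelTfSub_le_of_dvd W (one_dvd _)))
  -- (β2)
  have hβ2 : νf' (levelTf' W (lev n)) * νf (DZf ∩ ((ZfIn W : Set (torusFin W)) * levelTf W (lev n))) ≤
      suppMeasure W νf νf' γ₀ DZf (lev n) γ₀ :=
    prod_measure_inter_prod_univ_ge νf νf' (measurableSet_suppSet W γ₀ hN γ₀) hDZf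
      (isOpen_levelTf W hN).mul_left.measurableSet
      fun c hc => measure_levelTf'_le_measure_slice W νf' γ₀ (lev n) hc
  -- assemble
  calc unitCurrency W νf lev n * νf' (levelTf' W (lev n))
      = νf ((levelOneCentre W ⊔ levelTfSub W (lev n) : Subgroup (torusFin W)) : Set (torusFin W)) *
          νf' (levelTf' W (lev n)) := by
        rw [unitCurrency_def, coe_levelOneCentre_sup_levelTfSub]
    _ ≤ ((Nat.card (centreFin W ⊓ levelTfSub W 1 : Subgroup (torusFin W)) : ℝ≥0∞) *
          νf (((ZfIn W : Set (torusFin W)) * levelTf W (lev n)) ∩ DZf)) * νf' (levelTf' W (lev n)) := by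
        gcongr
    _ = (Nat.card (centreFin W ⊓ levelTfSub W 1 : Subgroup (torusFin W)) : ℝ≥0∞) *
          (νf' (levelTf' W (lev n)) * νf (DZf ∩ ((ZfIn W : Set (torusFin W)) * levelTf W (lev n)))) := by
        rw [Set.inter_comm]; ring
    _ ≤ (Nat.card (centreFin W ⊓ levelTfSub W 1 : Subgroup (torusFin W)) : ℝ≥0∞) *
          suppMeasure W νf νf' γ₀ DZf (lev n) γ₀ := by
        gcongr

/-- **`hβ` with the currency written out** (L1-p4's spelling, S15800): for RatioGlue's `unit_of_currency_of_beta` at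
`v := fun n => νf (((ZfIn W : Set _) ∩ levelTf W 1) * levelTf W (lev n))`. -/
theorem unit_beta' [νf.IsHaarMeasure] [νf'.IsHaarMeasure] (hDZf : MeasurableSet DZf)
    (hfd : IsFundamentalDomain (centreFin W) DZf νf) (hZ : CentreFinFinite W) (lev : ℕ → ℕ)
    (hlev : ∀ n, lev n ≠ 0) (n : ℕ) :
    νf (((ZfIn W : Set (torusFin W)) ∩ levelTf W 1) * levelTf W (lev n)) * νf' (levelTf' W (lev n)) ≤
      (Nat.card (centreFin W ⊓ levelTfSub W 1 : Subgroup (torusFin W)) : ℝ≥0∞) *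
        suppMeasure W νf νf' γ₀ DZf (lev n) γ₀ :=
  unit_beta W νf νf' γ₀ DZf hDZf hfd hZ lev hlev n

/-- **`hβ` at a single level `N ≠ 0`** (plan-4's R-BETA-LEVEL S15841: RatioAssembly's binder form
`∀ N, N ≠ 0 → …`), in L1-p4's spelling of the currency. -/
theorem unit_beta_of_ne_zero [νf.IsHaarMeasure] [νf'.IsHaarMeasure] (hDZf : MeasurableSet DZf)
    (hfd : IsFundamentalDomain (centreFin W) DZf νf) (hZ : CentreFinFinite W) (N : ℕ) (hN : N ≠ 0) :
    νf (((ZfIn W : Set (torusFin W)) ∩ levelTf W 1) * levelTf W N) * νf' (levelTf' W N) ≤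
      (Nat.card (centreFin W ⊓ levelTfSub W 1 : Subgroup (torusFin W)) : ℝ≥0∞) *
        suppMeasure W νf νf' γ₀ DZf N γ₀ :=
  unit_beta' W νf νf' γ₀ DZf hDZf hfd hZ (fun _ => N) (fun _ => hN) 0

/-- **`hv` OF RECORD — the unit is positive, from (β) alone** (no `hDZ`, any `DZf` with `hfd`): the currency is the
measure of an open set containing `levelTf N ∋ 1`, hence positive, and `νf′(levelTf′ N) > 0`; so the right side of
`unit_beta_of_ne_zero` is positive, whence `suppMeasure N γ₀ ≠ 0`; with `hfin` its `toReal` is positive. -/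
theorem suppMeasure_toReal_pos_of_beta [νf.IsHaarMeasure] [νf'.IsHaarMeasure] (hDZf : MeasurableSet DZf)
    (hfd : IsFundamentalDomain (centreFin W) DZf νf) (hZ : CentreFinFinite W) {N : ℕ} (hN : N ≠ 0)
    (hfin : suppMeasure W νf νf' γ₀ DZf N γ₀ ≠ ⊤) : 0 < (suppMeasure W νf νf' γ₀ DZf N γ₀).toReal := by
  have hβ := unit_beta_of_ne_zero W νf νf' γ₀ DZf hDZf hfd hZ N hN
  -- the currency is positive: the set contains the open non-empty `levelTf N`
  have hsub : levelTf W N ⊆ ((ZfIn W : Set (torusFin W)) ∩ levelTf W 1) * levelTf W N := by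
    intro l hl
    exact ⟨1, ⟨one_mem _, one_mem_levelTf W 1⟩, l, hl, one_mul l⟩
  have hpos₁ : 0 < νf (((ZfIn W : Set (torusFin W)) ∩ levelTf W 1) * levelTf W N) :=
    lt_of_lt_of_le ((isOpen_levelTf W hN).measure_pos νf ⟨1, one_mem_levelTf W N⟩) (measure_mono hsub)
  have hpos₂ : 0 < νf' (levelTf' W N) := (measure_levelTf'_pos_lt_top W νf' hN).1
  have hlhs : 0 < νf (((ZfIn W : Set (torusFin W)) ∩ levelTf W 1) * levelTf W N) * νf' (levelTf' W N) :=
    ENNReal.mul_pos hpos₁.ne' hpos₂.ne'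
  have hne : suppMeasure W νf νf' γ₀ DZf N γ₀ ≠ 0 := by
    intro h0
    rw [h0, mul_zero] at hβ
    exact hlhs.ne' (le_antisymm hβ zero_le)
  exact ENNReal.toReal_pos hne hfin

end Beta

end Summit.Ventures.HodgeRepro.Tier4.Line4

end
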